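import Mathlib
import Summits.ValiantsHypothesis.ValiantsHypothesis.Theses.BinomialElusive

/-!
# `NoShortRelations` (stmt-ValiantsHypothesis-7395, route BinomialElusive, support item, rank 9)

The carry-free power-sum exponents `E(j) = Σ_{k ≤ h} (j · M)^k`, `M = (2m+2)^{h+1}`, admit no
nonzero integer relation of length `≤ h`: if `w : Fin (2m) → ℤ` has `Σ_j |w_j| ≤ h` and
`Σ_j w_j E(j+1) = 0` then `w = 0` (`noShortRelations_proof` closes
`Summit.ValiantsHypothesis.ValiantsHypothesis.Theses.BinomialElusive.NoShortRelations`).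

Proof (the route card's argument, made formal):
* §1 `Σ_j w_j E(j+1) = Σ_{k ≤ h} d_k M^k` with "digits" `d_k = Σ_j w_j (j+1)^k`;
* §2 `|d_k| ≤ h (2m)^h ≤ (2m+1)^{h+1} < M` (elementary: `h a^h ≤ (a+1)^{h+1}` by induction on `h`);
* §3 balanced base-`M` uniqueness (induction on the number of digits, reducing mod `M`) gives
  `d_k = 0` for all `k ≤ h`;
* §4 the support of `w` has at most `h` points (each nonzero `w_j` contributes `≥ 1` to `Σ|w_j|`),
  the nodes `j+1` are distinct, so the Vandermonde system `d_0 = … = d_h = 0` restricted to the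
  support forces `w = 0` (`Matrix.eq_zero_of_forall_pow_sum_mul_pow_eq_zero`).

[folklore; elementary additive combinatorics / Vandermonde]
-/

namespace Summit.ValiantsHypothesis.ValiantsHypothesis.Theorems.BinomialElusiveNoShortRelations

-- summit = sub-problem name (single-conjunct summit, D-0017 layout), so the namespace repeats it
set_option linter.dupNamespace false

open scoped BigOperators
open Finset

/-- Elementary growth bound used for the digit estimate: `h · a^h ≤ (a+1)^(h+1)` for all naturals
`a, h` (induction on `h`). -/
theorem mul_pow_le_succ_pow_succ (a : ℕ) : ∀ h : ℕ, h * a ^ h ≤ (a + 1) ^ (h + 1) := by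
  intro h
  induction h with
  | zero => simp
  | succ h ih =>
    have h1 : a ^ (h + 1) ≤ (a + 1) ^ (h + 1) := Nat.pow_le_pow_left (Nat.le_succ a) _
    calc (h + 1) * a ^ (h + 1) = a * (h * a ^ h) + a ^ (h + 1) := by ring
      _ ≤ a * (a + 1) ^ (h + 1) + (a + 1) ^ (h + 1) :=
          Nat.add_le_add (Nat.mul_le_mul_left _ ih) h1
      _ = (a + 1) ^ (h + 1 + 1) := by ring

/-- The digit bound of §2: `h · (2m)^h < (2m+2)^(h+1)`. -/
theorem mul_pow_lt_base (m h : ℕ) : h * (2 * m) ^ h < (2 * m + 2) ^ (h + 1) :=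
  lt_of_le_of_lt (mul_pow_le_succ_pow_succ (2 * m) h)
    (Nat.pow_lt_pow_left (by omega) (Nat.succ_ne_zero h))

/-- Balanced base-`M` uniqueness (§3): if `Σ_{k<n} d_k M^k = 0` with all `|d_k| < M` then every
digit `d_k` (`k < n`) vanishes. -/
theorem digits_eq_zero (M : ℤ) (hM : 0 < M) :
    ∀ (n : ℕ) (d : ℕ → ℤ), (∀ k < n, |d k| < M) → ∑ k ∈ Finset.range n, d k * M ^ k = 0 →
      ∀ k < n, d k = 0 := by
  intro n
  induction n with
  | zero => intro d _ _ k hk; exact absurd hk (Nat.not_lt_zero k)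
  | succ n ih =>
    intro d hd hs k hk
    rw [Finset.sum_range_succ'] at hs
    have htail : ∑ k ∈ Finset.range n, d (k + 1) * M ^ (k + 1)
        = M * ∑ k ∈ Finset.range n, d (k + 1) * M ^ k := by
      rw [Finset.mul_sum]
      exact Finset.sum_congr rfl fun k _ => by ring
    rw [htail, pow_zero, mul_one] at hs
    have h0 : d 0 = 0 := by
      refine Int.eq_zero_of_abs_lt_dvd ?_ (hd 0 (Nat.succ_pos n))
      exact ⟨-(∑ k ∈ Finset.range n, d (k + 1) * M ^ k), by linarith⟩
    have hrest : ∑ k ∈ Finset.range n, d (k + 1) * M ^ k = 0 := by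
      rw [h0, add_zero] at hs
      exact (mul_eq_zero.mp hs).resolve_left hM.ne'
    have ih' := ih (fun k => d (k + 1)) (fun k hk => hd (k + 1) (by omega)) hrest
    rcases k with _ | k
    · exact h0
    · exact ih' k (by omega)

/-- **NoShortRelations** (stmt-ValiantsHypothesis-7395): the carry-free power-sum exponents
`E(j) = Σ_{k ≤ h} (j (2m+2)^{h+1})^k` have no nonzero integer relation `Σ_j w_j E(j+1) = 0` of
length `Σ_j |w_j| ≤ h`. -/
theorem noShortRelations_proof :
    Summit.ValiantsHypothesis.ValiantsHypothesis.Theses.BinomialElusive.NoShortRelations := by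
  unfold Summit.ValiantsHypothesis.ValiantsHypothesis.Theses.BinomialElusive.NoShortRelations
  intro m h w hw hrel
  -- §1: the relation is a base-`M` expansion with digits `d_k = Σ_j w_j (j+1)^k`.
  have hdigits : ∑ k ∈ Finset.range (h + 1),
      (∑ j : Fin (2 * m), w j * (((j : ℕ) : ℤ) + 1) ^ k) * ((2 * (m : ℤ) + 2) ^ (h + 1)) ^ k = 0 := by
    have key : ∀ j : Fin (2 * m), (w j : ℤ) * ((∑ k ∈ Finset.range (h + 1),
        (((j : ℕ) + 1) * (2 * m + 2) ^ (h + 1)) ^ k : ℕ) : ℤ)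
        = ∑ k ∈ Finset.range (h + 1),
            w j * (((j : ℕ) : ℤ) + 1) ^ k * ((2 * (m : ℤ) + 2) ^ (h + 1)) ^ k := by
      intro j
      push_cast
      rw [Finset.mul_sum]
      exact Finset.sum_congr rfl fun k _ => by rw [mul_pow, ← mul_assoc]
    rw [Finset.sum_congr rfl (fun j _ => key j), Finset.sum_comm] at hrel
    simpa only [Finset.sum_mul] using hrel
  -- §2: every digit is smaller than the base in absolute value.
  have hbound : ∀ k < h + 1,
      |∑ j : Fin (2 * m), w j * (((j : ℕ) : ℤ) + 1) ^ k| < (2 * (m : ℤ) + 2) ^ (h + 1) := by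
    intro k hk
    have hk' : k ≤ h := Nat.lt_succ_iff.mp hk
    calc |∑ j : Fin (2 * m), w j * (((j : ℕ) : ℤ) + 1) ^ k|
        ≤ ∑ j : Fin (2 * m), |w j * (((j : ℕ) : ℤ) + 1) ^ k| := Finset.abs_sum_le_sum_abs _ _
      _ ≤ ∑ j : Fin (2 * m), |w j| * (2 * (m : ℤ)) ^ h := by
          refine Finset.sum_le_sum fun j _ => ?_
          rw [abs_mul]
          refine mul_le_mul_of_nonneg_left ?_ (abs_nonneg _)
          have hj : (((j : ℕ) : ℤ) + 1) ≤ 2 * (m : ℤ) := by have := j.isLt; omega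
          have hj0 : (0 : ℤ) ≤ ((j : ℕ) : ℤ) + 1 := by positivity
          rw [abs_of_nonneg (pow_nonneg hj0 _)]
          calc (((j : ℕ) : ℤ) + 1) ^ k ≤ (2 * (m : ℤ)) ^ k := pow_le_pow_left₀ hj0 hj k
            _ ≤ (2 * (m : ℤ)) ^ h := pow_le_pow_right₀ (by have := j.isLt; omega) hk'
      _ = (∑ j : Fin (2 * m), |w j|) * (2 * (m : ℤ)) ^ h := (Finset.sum_mul _ _ _).symm
      _ ≤ (h : ℤ) * (2 * (m : ℤ)) ^ h := mul_le_mul_of_nonneg_right hw (by positivity)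
      _ < (2 * (m : ℤ) + 2) ^ (h + 1) := by exact_mod_cast mul_pow_lt_base m h
  -- §3: all digits vanish.
  have hzero : ∀ k < h + 1, (∑ j : Fin (2 * m), w j * (((j : ℕ) : ℤ) + 1) ^ k) = 0 :=
    digits_eq_zero ((2 * (m : ℤ) + 2) ^ (h + 1)) (by positivity) (h + 1)
      (fun k => ∑ j : Fin (2 * m), w j * (((j : ℕ) : ℤ) + 1) ^ k) hbound hdigits
  -- §4: Vandermonde on the support of `w`.
  funext j₀
  rw [Pi.zero_apply]
  by_contra hj₀
  set s : Finset (Fin (2 * m)) := Finset.univ.filter (fun j => w j ≠ 0) with hs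
  have hmem : ∀ j, j ∈ s ↔ w j ≠ 0 := fun j => by simp [hs]
  have hcard : s.card ≤ h := by
    have h1 : ((s.card : ℕ) : ℤ) ≤ ∑ j ∈ s, |w j| := by
      have h1' : ∑ j ∈ s, (1 : ℤ) = s.card := by simp
      rw [← h1']
      exact Finset.sum_le_sum fun j hj => Int.one_le_abs ((hmem j).mp hj)
    have h2 : ∑ j ∈ s, |w j| ≤ ∑ j, |w j| :=
      Finset.sum_le_univ_sum_of_nonneg fun j => abs_nonneg (w j)
    have h3 : (s.card : ℤ) ≤ h := h1.trans (h2.trans hw)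
    exact_mod_cast h3
  obtain ⟨e⟩ : Nonempty (Fin s.card ≃ {x // x ∈ s}) := ⟨s.equivFin.symm⟩
  have hf : Function.Injective (fun i : Fin s.card => (((e i : Fin (2 * m)) : ℕ) : ℤ) + 1) := by
    intro a b hab
    have hab' : (((e a : Fin (2 * m)) : ℕ) : ℤ) + 1 = (((e b : Fin (2 * m)) : ℕ) : ℤ) + 1 := hab
    exact e.injective (Subtype.ext (Fin.ext (by exact_mod_cast (add_right_cancel hab'))))
  have hv : (fun i : Fin s.card => w (e i)) = 0 := by
    refine Matrix.eq_zero_of_forall_pow_sum_mul_pow_eq_zero hf fun i => ?_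
    show ∑ j : Fin s.card, w (e j) * ((((e j : Fin (2 * m)) : ℕ) : ℤ) + 1) ^ (i : ℕ) = 0
    have h1 : ∑ j : Fin s.card, w (e j) * ((((e j : Fin (2 * m)) : ℕ) : ℤ) + 1) ^ (i : ℕ)
        = ∑ x : {x // x ∈ s}, w x * ((((x : Fin (2 * m)) : ℕ) : ℤ) + 1) ^ (i : ℕ) :=
      Fintype.sum_equiv e _ _ fun _ => rfl
    have h2 : ∑ x ∈ s, w x * (((x : ℕ) : ℤ) + 1) ^ (i : ℕ)
        = ∑ x, w x * (((x : ℕ) : ℤ) + 1) ^ (i : ℕ) := by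
      refine Finset.sum_subset (Finset.subset_univ _) fun x _ hx => ?_
      have hx' : w x = 0 := by simpa [hmem] using hx
      simp [hx']
    rw [h1, Finset.sum_coe_sort s (fun x => w x * (((x : ℕ) : ℤ) + 1) ^ (i : ℕ)), h2]
    exact hzero i (by have := i.isLt; omega)
  have hval := congr_fun hv (e.symm ⟨j₀, (hmem j₀).mpr hj₀⟩)
  simp only [Equiv.apply_symm_apply, Pi.zero_apply] at hval
  exact hj₀ hval

end Summit.ValiantsHypothesis.ValiantsHypothesis.Theorems.BinomialElusiveNoShortRelations
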